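import Literature.MathematicalPhysics.KineticTheory.ShortRangePotentialsProofs
import HarnessLib

/-!
# The iterated Duhamel formula almost everywhere for the marginals of a transported symmetric
# Gaussian-bounded datum (CIP 1994 Thm 4.3.1 and (4.7) "for almost all `z^s`", general data)

(Topic MathematicalPhysics/KineticTheory; theorems only — no definition, no named fact. Part of the
bottom-up proof plan of the named facts `lanford_tendstoEmpirical` (**hilbert6.S08**) and `lanford`
(**hilbert6.S02**) of `Literature/MathematicalPhysics/KineticTheory/Sweep1.lean`.)

Let `W` be a measurable, permutation-symmetric function of `N` hard spheres of diameter `ε` on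
`T^d` (`0 < ε < 1/2`) with a Gaussian bound `|W| ≤ C e^{-β E}`, and let
`f^{(s)}(t) := transportedMarginal (regHardSphereFlow hε hε' ·) W s t = ∫ (1_{good} W ∘ Φ^N_{-t})(Z_s, ·)`
be the honest marginals of its transport along the regularised Alexander flow. The chain
`HardSphereMildBBGKY*` ⟶ `ShortRangePotentialsProofs.oneStep_ae_good` (CIP 1994 Thm 4.3.1, strong
form, for symmetric Gaussian-bounded weights), the contact trace `TaggedSphereContactTrace` and the
source induction `HardSphereDuhamelFormula.hs_seriesFamily_ae_eq_of_oneStep` were written for the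
marginals of BGSR's datum (`bgsrMarginalFamily`); nothing in them is specific to that datum. This
file carries them over to the general datum `W`:

* §1 the family `f^{(s)}(t)`: unfolding, vanishing above `N` and off the domains, measurability
  (slices and jointly in `(t, Z)`), the Gaussian bound `C (∫ e^{-βE}) e^{-βE}` and the Lanford class
  uniformly in time (`isNiceT_transportedMarginal`);
* §2 **(H1)** `transportedMarginal_oneStep` — the one-step integrated BBGKY hierarchy of the
  `N`-sphere model `hsHierarchyModel hε hε' N` for `f`, at every level and every `t ≥ 0`, almost
  everywhere (CIP 1994 Thm 4.3.1; the all-level assembly of `bgsr_oneStep_H1`);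
* §3 **(H1♯)** `transportedMarginal_oneStep_sharp` — the same identity at the outgoing adjoined
  contact configurations read by the collision operators, for a.e. collision parameter (port of
  `contactTrace_core`, BGSR 2016 Remark 3.1; CIP 1994 (4.3.4) "continuity along trajectories");
* §4 **(S)** `seriesFamily_ae_eq_transportedMarginal` — for `d ≥ 2`, every `s` and `t ≥ 0`, the finite
  Duhamel series of the time-`0` marginals is a version of `f^{(s)}(t)` (CIP 1994 (4.7));
  `seriesFamily_nthMarginal_ae_eq_transportedMarginal` — the same with the honest initial marginals
  `nthMarginal N · W` as data when `W` vanishes off `D_ε^N` (`hsHierarchyModel_respectsAEOn`);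
  `nthMarginal_indicator_hsTransport_ae_eq` — independence of the hard-sphere flow used (GST 2013
  Prop. 4.1.1);
* §5 the two instances feeding the Lanford programme: the conditioned (canonical) data
  `canonicalDensity` of a Lanford datum (hilbert6.S08) and the sectors `gcInitial … n` of the Gibbs
  grand-canonical data (hypothesis (S) of `lanford_of_sectorwise_of_termwise`, hilbert6.S02), whence
  `lanford_of_termwise`: **`lanford` follows from the term-by-term convergence (C) alone**.

## References

* C. Cercignani, R. Illner, M. Pulvirenti, *The Mathematical Theory of Dilute Gases*, Applied
  Mathematical Sciences 106, Springer (1994), §4.3 Thm 4.3.1 and (4.3.4), §4.4 (4.7), App. 4.A–4.B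
  (bib key `CIP1994`).
* T. Bodineau, I. Gallagher, L. Saint-Raymond, *The Brownian motion as the limit of a deterministic
  system of hard-spheres*, Invent. Math. 203 (2016) 493–553, §3.1 Remark 3.1 (bib key
  `BodineauGallagherSaintRaymondInvent2016`).
* I. Gallagher, L. Saint-Raymond, B. Texier, *From Newton to Boltzmann* (2013) = arXiv:1208.5753,
  Prop. 4.1.1, (4.3.7)–(4.3.8), Ch. 6 §6.1 (bib key `GST2013`).
-/

open MeasureTheory MeasureTheory.Measure Metric Real Set Filter Function Topology
open scoped ENNReal InnerProductSpace
open Literature.Analysis.FluidPDE Literature.Analysis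

namespace Literature.MathematicalPhysics.KineticTheory

noncomputable section

set_option synthInstance.maxSize 1024

section Kinetic

variable {d : Type*} [Fintype d]

/-! ## §1. The marginal family of a transported datum -/

section Family

variable {ε : ℝ} (hε : 0 < ε) (hε' : ε < 2⁻¹) {N : ℕ} (W : Config N d (UnitAddTorus d) → ℝ)

/-- Unfolding: `f^{(s)}(t) = nthMarginal N s (1_{good} · W ∘ Φ_{-t})` along the regularised flow.
[folklore] -/
theorem transportedMarginal_reg_apply (s : ℕ) (t : ℝ) :
    transportedMarginal (fun n => Alexander.regHardSphereFlow (d := d) hε hε' n) W s t =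
      nthMarginal N s ((Alexander.good (Torus.geometry d) ε).indicator
        (fun w => W (Alexander.regFlow (Torus.geometry d) ε (-t) w))) := by
  unfold transportedMarginal
  simp only [Alexander.regHardSphereFlow_good]
  rfl

/-- At time `0` the family is the family of marginals of `1_{good} W`. [folklore] -/
theorem transportedMarginal_reg_zero (s : ℕ) :
    transportedMarginal (fun n => Alexander.regHardSphereFlow (d := d) hε hε' n) W s 0 =
      nthMarginal N s ((Alexander.good (Torus.geometry d) ε).indicator W) := by
  rw [transportedMarginal_reg_apply]
  simp only [neg_zero, Alexander.regFlow_zero hε hε']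

/-- The family vanishes above `N` particles. [folklore] -/
theorem transportedMarginal_reg_eq_zero_of_lt {s : ℕ} (hs : N < s) (t : ℝ) :
    transportedMarginal (fun n => Alexander.regHardSphereFlow (d := d) hε hε' n) W s t = 0 := by
  funext Z
  rw [transportedMarginal_reg_apply]
  simp [nthMarginal, not_le.2 hs]

/-- The transported density `1_{good} W ∘ Φ_{-t}` inherits the Gaussian bound of `W`. [folklore] -/
theorem abs_indicator_good_regFlow_le {C β : ℝ} (hC : 0 ≤ C)
    (hWb : ∀ z, |W z| ≤ C * Real.exp (-β * configEnergy z)) (t : ℝ) (w : Config N d (UnitAddTorus d)) :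
    |(Alexander.good (Torus.geometry d) ε).indicator
        (fun w => W (Alexander.regFlow (Torus.geometry d) ε (-t) w)) w| ≤ C * Real.exp (-β * configEnergy w) := by
  by_cases hw : w ∈ Alexander.good (Torus.geometry d) ε
  · rw [indicator_of_mem hw]
    have h := hWb (Alexander.regFlow (Torus.geometry d) ε (-t) w)
    rwa [Alexander.configEnergy_regFlow] at h
  · rw [indicator_of_notMem hw, abs_zero]; positivity

include hε' in
/-- Each slice `f^{(s)}(t)` is measurable (measurable `W`). [folklore] -/
theorem measurable_transportedMarginal_reg (hWm : Measurable W) (s : ℕ) (t : ℝ) :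
    Measurable (transportedMarginal (fun n => Alexander.regHardSphereFlow (d := d) hε hε' n) W s t) := by
  rw [transportedMarginal_reg_apply]
  exact measurable_nthMarginal N s ((hWm.comp (Alexander.measurable_regFlow hε' _)).indicator
    (Alexander.regHardSphereFlow (d := d) hε hε' N).measurableSet_good)

include hε' in
/-- **Joint measurability** of `(t, Z) ↦ f^{(s)}(t, Z)` (`measurable_fden_uncurry`,
`measurable_nthMarginal_param`). [folklore] -/
theorem measurable_transportedMarginal_reg_uncurry (hWm : Measurable W) (s : ℕ) :
    Measurable fun p : ℝ × Config s d (UnitAddTorus d) =>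
      transportedMarginal (fun n => Alexander.regHardSphereFlow (d := d) hε hε' n) W s p.1 p.2 := by
  have hρ := measurable_fden_uncurry (d := d) (ε := ε) (N := N) hε' hWm
  have h := measurable_nthMarginal_param N s hρ
  simp only [transportedMarginal_reg_apply]
  exact h

/-- **The Gaussian bound of the family**: `|f^{(s)}(t, Z)| ≤ C (∫ e^{-βE}) e^{-βE(Z)}`
(`abs_nthMarginal_le_gaussian`; the levels above `N` vanish). [folklore] -/
theorem abs_transportedMarginal_reg_le {C β : ℝ} (hC : 0 ≤ C) (hβ : 0 < β)
    (hWb : ∀ z, |W z| ≤ C * Real.exp (-β * configEnergy z)) (s : ℕ) (t : ℝ) (Z : Config s d (UnitAddTorus d)) :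
    |transportedMarginal (fun n => Alexander.regHardSphereFlow (d := d) hε hε' n) W s t Z| ≤
      C * (∫ Zm : Config (N - s) d (UnitAddTorus d), Real.exp (-β * configEnergy Zm)) *
        Real.exp (-β * configEnergy Z) := by
  rcases le_or_gt s N with hs | hs
  · rw [transportedMarginal_reg_apply]
    exact abs_nthMarginal_le_gaussian hs hβ (abs_indicator_good_regFlow_le W hC hWb t) Z
  · rw [transportedMarginal_reg_eq_zero_of_lt hε hε' W hs]
    simp only [Pi.zero_apply, abs_zero]
    have : 0 ≤ ∫ Zm : Config (N - s) d (UnitAddTorus d), Real.exp (-β * configEnergy Zm) :=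
      integral_nonneg fun _ => (Real.exp_pos _).le
    positivity

include hε' in
/-- **The family is in the Lanford class uniformly in time** (`IsNiceT` on every horizon). [folklore] -/
theorem isNiceT_transportedMarginal_reg (hWm : Measurable W) {C β : ℝ} (hC : 0 ≤ C) (hβ : 0 < β)
    (hWb : ∀ z, |W z| ≤ C * Real.exp (-β * configEnergy z)) (s : ℕ) (T : ℝ) :
    IsNiceT T (transportedMarginal (fun n => Alexander.regHardSphereFlow (d := d) hε hε' n) W s) :=
  ⟨measurable_transportedMarginal_reg_uncurry hε hε' W hWm s,
    C * (∫ Zm : Config (N - s) d (UnitAddTorus d), Real.exp (-β * configEnergy Zm)), β, hβ,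
    fun t _ Z => abs_transportedMarginal_reg_le hε hε' W hC hβ hWb s t Z⟩

end Family

/-! ## §2. (H1): the one-step integrated hierarchy, almost everywhere, at every level -/

section OneStep

variable {ε : ℝ} (hε : 0 < ε) (hε' : ε < 2⁻¹) {N : ℕ} (W : Config N d (UnitAddTorus d) → ℝ)

set_option maxHeartbeats 4000000 in
include hε hε' in
/-- **(H1) for the marginals of a transported symmetric Gaussian-bounded datum: the one-step mild
BBGKY hierarchy, almost everywhere** (CIP 1994 Thm 4.3.1). For `d ≥ 2`, `0 < ε < 1/2`, a measurable
permutation-symmetric `W` on `Config N` with `|W| ≤ C e^{-βE}` (`β > 0`), every level `k`, every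
`t ≥ 0` and a.e. `Z ∈ Config k`,
`f^{(k)}(t)(Z) = f^{(k)}(0)(Φ_{-t} Z) + ∫_0^t (C^{out}_{k,k+1} f^{(k+1)}(τ))(Φ_{-(t-τ)} Z) dτ`
for the `N`-sphere model `hsHierarchyModel hε hε' N` (`oneStep_ae_good` at the levels `1 ≤ k < N` for
`t > 0`; conservation of mass at `k = 0`; the top level `k = N` is transport; the levels `k > N`
vanish; off the hard-sphere domain both sides vanish and `D_k ∖ good_k` is null).
[cite: CIP1994, §4.3 Thm 4.3.1] -/
theorem transportedMarginal_oneStep [DecidableEq d] (hd : 2 ≤ Fintype.card d) (hWm : Measurable W)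
    (hWσ : ∀ (σ : Equiv.Perm (Fin N)) (z : Config N d (UnitAddTorus d)),
      W (z ∘ σ : Config N d (UnitAddTorus d)) = W z)
    {C β : ℝ} (hC : 0 ≤ C) (hβ : 0 < β) (hWb : ∀ z, |W z| ≤ C * Real.exp (-β * configEnergy z))
    (k : ℕ) {t : ℝ} (ht : 0 ≤ t) :
    ∀ᵐ Z : Config k d (UnitAddTorus d),
      transportedMarginal (fun n => Alexander.regHardSphereFlow (d := d) hε hε' n) W k t Z =
        (hsHierarchyModel (d := d) hε hε' N).transport k t
            (transportedMarginal (fun n => Alexander.regHardSphereFlow (d := d) hε hε' n) W k 0) Z +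
          ∫ τ in (0 : ℝ)..t, (hsHierarchyModel (d := d) hε hε' N).transport k (t - τ)
            ((hsHierarchyModel (d := d) hε hε' N).op k
              (transportedMarginal (fun n => Alexander.regHardSphereFlow (d := d) hε hε' n) W (k + 1) τ)) Z := by
  haveI : Nonempty d := Fintype.card_pos_iff.1 (by omega)
  haveI hXE : SigmaFinite (volume : Measure (UnitAddTorus d × EuclideanSpace ℝ d)) := inferInstance
  have hG := Torus.isHardSphereRegular_geometry (d := d) hε'
  have hGm := Torus.isMeasurable_geometry (d := d)
  simp only [hsHierarchyModel_transport_apply, hsHierarchyModel_op]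
  -- notation
  set f : (s : ℕ) → ℝ → Config s d (UnitAddTorus d) → ℝ :=
    transportedMarginal (fun n => Alexander.regHardSphereFlow (d := d) hε hε' n) W with hf
  set FD : ℝ → Config N d (UnitAddTorus d) → ℝ := fun s =>
    (Alexander.good (Torus.geometry d) ε).indicator (fun w => W (Alexander.regFlow (Torus.geometry d) ε (-s) w)) with hFD
  have hfFD : ∀ (s : ℕ) (τ : ℝ), f s τ = nthMarginal N s (FD τ) := fun s τ => by
    simp only [hf, hFD]; exact transportedMarginal_reg_apply hε hε' W s τ
  -- the time `t = 0`
  rcases ht.eq_or_lt with rfl | htpos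
  · refine ae_of_all _ fun Z => ?_
    simp [neg_zero, Alexander.regFlow_zero hε hε']
  -- vanishing of the operator term at and above level `N`
  have hop0 : ∀ (k : ℕ), N ≤ k → ∀ (τ : ℝ) (Z : Config k d (UnitAddTorus d)),
      outBbgkyOp (Torus.geometry d) ε N k (f (k + 1) τ) Z = 0 := by
    intro k hk τ Z
    have hzero : f (k + 1) τ = 0 := by
      simp only [hf]; exact transportedMarginal_reg_eq_zero_of_lt hε hε' W (by omega) τ
    rw [hzero]
    simp [outBbgkyOp, bbgkyCollisionOp, hsCollisionTerm]
  -- the levels `k > N`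
  rcases Nat.lt_or_ge N k with hk | hk
  · refine ae_of_all _ fun Z => ?_
    have hzero : ∀ τ, f k τ = 0 := fun τ => by
      simp only [hf]; exact transportedMarginal_reg_eq_zero_of_lt hε hε' W hk τ
    simp only [hzero, Pi.zero_apply, hop0 k hk.le, intervalIntegral.integral_zero, add_zero]
  -- the level `k = N`
  rcases hk.eq_or_lt with rfl | hk
  · refine ae_of_all _ fun Z => ?_
    simp only [hop0 k le_rfl, intervalIntegral.integral_zero, add_zero]
    rw [hfFD, hfFD, nthMarginal_self_apply, nthMarginal_self_apply]
    simp only [hFD]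
    rw [indicator_good_regFlow hε hε' (-t)]
    simp only [neg_zero, Alexander.regFlow_zero hε hε']
  -- the level `k = 0`: conservation of mass
  rcases Nat.eq_zero_or_pos k with rfl | hkpos
  · refine ae_of_all _ fun Z => ?_
    have hop : ∀ (τ : ℝ) (Z' : Config 0 d (UnitAddTorus d)), outBbgkyOp (Torus.geometry d) ε N 0 (f 1 τ) Z' = 0 := by
      intro τ Z'; simp [outBbgkyOp]
    simp only [hop, intervalIntegral.integral_zero, add_zero]
    rw [hfFD, hfFD, nthMarginal_zero_apply, nthMarginal_zero_apply]
    -- `∫ 1_{good} W ∘ Φ_{-t} = ∫ 1_{good} W` by Liouville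
    have hmp := measurePreserving_regFlow_volume (d := d) (N := N) hε hε' (-t)
    have hg : AEStronglyMeasurable ((Alexander.good (Torus.geometry d) ε).indicator W)
        (Measure.map (Alexander.regFlow (Torus.geometry d) ε (-t)) volume) := by
      rw [hmp.map_eq]; exact (hWm.indicator (Alexander.measurableSet_good hG hGm)).aestronglyMeasurable
    have h1 := integral_map (hmp.measurable.aemeasurable) hg
    rw [hmp.map_eq] at h1
    simp only [hFD]
    simp_rw [← indicator_good_regFlow hε hε' (-t) W]
    rw [← h1]
    simp only [neg_zero, Alexander.regFlow_zero hε hε']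
  -- the levels `1 ≤ k < N`
  haveI : NeZero k := ⟨by omega⟩
  obtain ⟨m', hm'⟩ : ∃ m', N = k + (m' + 1) := ⟨N - k - 1, by omega⟩
  have hkm : k + (m' + 1) = k + 1 + m' := by omega
  -- the re-indexed datum
  set W' : Config (k + (m' + 1)) d (UnitAddTorus d) → ℝ := fun z => W (fun i => z (Fin.cast hm' i)) with hW'
  have hW'm : Measurable W' := hWm.comp (measurable_comp_cast hm')
  have hW'b : ∀ z, |W' z| ≤ C * Real.exp (-β * configEnergy z) := by
    intro z
    simp only [hW']
    have h := hWb (fun i => z (Fin.cast hm' i))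
    rwa [configEnergy_comp_cast] at h
  have hW'σ : ∀ σ : Equiv.Perm (Fin (k + (m' + 1))),
      (∀ j : Fin k, σ (Fin.castAdd (m' + 1) j) = Fin.castAdd (m' + 1) j) →
      ∀ z : Config (k + (m' + 1)) d (UnitAddTorus d),
        W' (z ∘ σ : Config (k + (m' + 1)) d (UnitAddTorus d)) = W' z := by
    intro σ _ z
    set σ' : Equiv.Perm (Fin N) := (finCongr hm').trans (σ.trans (finCongr hm').symm) with hσ'
    have heq : (fun i => (z ∘ σ) (Fin.cast hm' i)) = ((fun i => z (Fin.cast hm' i)) ∘ σ' : Config N d (UnitAddTorus d)) := by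
      funext i
      simp only [Function.comp_apply, hσ', Equiv.trans_apply, finCongr_apply, finCongr_symm]
      congr 1
    simp only [hW']
    rw [heq]
    exact hWσ σ' _
  -- the one-step formula along the good set, for the weight `W'`
  have hmain := oneStep_ae_good (d := d) hε hε' htpos hW'm hW'σ hC hβ hW'b hkm
  -- the bridge `FD s ∘ cast = FDEN_{W'} s`
  have hbridge : ∀ (s : ℝ) (z : Config (k + (m' + 1)) d (UnitAddTorus d)),
      FD s (fun i => z (Fin.cast hm' i)) =
        (Alexander.good (Torus.geometry d) ε).indicator
          (fun w => W' (Alexander.regFlow (Torus.geometry d) ε (-s) w)) z := by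
    intro s z
    simp only [hW', hFD]
    by_cases hz : z ∈ Alexander.good (Torus.geometry d) ε
    · have hzc : (fun i => z (Fin.cast hm' i) : Config N d (UnitAddTorus d)) ∈ Alexander.good (Torus.geometry d) ε :=
        (comp_cast_mem_good_iff hm' z).2 hz
      rw [indicator_of_mem hzc, indicator_of_mem hz, regFlow_comp_cast hm']
    · rw [indicator_of_notMem hz, indicator_of_notMem (fun h => hz ((comp_cast_mem_good_iff hm' z).1 h))]
  have hfk : ∀ s : ℝ, f k s = nthMarginal (k + (m' + 1)) k
      ((Alexander.good (Torus.geometry d) ε).indicator (fun w => W' (Alexander.regFlow (Torus.geometry d) ε (-s) w))) := by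
    intro s
    rw [hfFD, ← nthMarginal_comp_cast hm']
    congr 1
    funext z
    exact hbridge s z
  have hfk1 : ∀ τ : ℝ, f (k + 1) τ = nthMarginal (k + 1 + m') (k + 1) (fun z : Config (k + 1 + m') d (UnitAddTorus d) =>
      (Alexander.good (Torus.geometry d) ε).indicator (fun w => W' (Alexander.regFlow (Torus.geometry d) ε (-τ) w))
        (fun j => z (Fin.cast hkm j))) := by
    intro τ
    rw [hfFD, ← nthMarginal_comp_cast (hm'.trans hkm)]
    congr 1
    funext z
    rw [← hbridge τ]
    rfl
  have hNop : ∀ (g : Config (k + 1) d (UnitAddTorus d) → ℝ),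
      outBbgkyOp (Torus.geometry d) ε N k g = outBbgkyOp (Torus.geometry d) ε (k + m' + 1) k g := by
    intro g
    rw [show N = k + m' + 1 by omega]
  -- off the hard-sphere domain both sides vanish; `D_k ∖ good_k` is null
  have hnull : ∀ᵐ Z : Config k d (UnitAddTorus d),
      Z ∉ hardSphereDomain (Torus.geometry d) k ε \ Alexander.good (Torus.geometry d) ε := by
    have h := HardSphereFlow.volume_diff_good (d := d) (Alexander.regHardSphereFlow (d := d) hε hε' k)
    simp only [Alexander.regHardSphereFlow_good] at h
    exact measure_eq_zero_iff_ae_notMem.1 h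
  filter_upwards [hmain, hnull] with Z hZ hZn
  rw [intervalIntegral.integral_of_le htpos.le]
  by_cases hZD : Z ∈ hardSphereDomain (Torus.geometry d) k ε
  · have hZg : Z ∈ Alexander.good (Torus.geometry d) ε := by
      by_contra h; exact hZn ⟨hZD, h⟩
    have h := hZ hZg
    rw [hfk t, hfk 0]
    simp_rw [hNop, hfk1]
    simpa only [neg_zero] using h
  · have hZg : Z ∉ Alexander.good (Torus.geometry d) ε := fun h => hZD (Alexander.good_subset_hardSphereDomain h)
    have h1 : f k t Z = 0 := by
      simp only [hf]; exact transportedMarginal_eq_zero_of_not_mem _ _ t hZD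
    have h2 : f k 0 (Alexander.regFlow (Torus.geometry d) ε (-t) Z) = 0 := by
      rw [Alexander.regFlow_of_not_mem hZg]
      simp only [hf]; exact transportedMarginal_eq_zero_of_not_mem _ _ 0 hZD
    have h3 : ∀ τ, outBbgkyOp (Torus.geometry d) ε N k (f (k + 1) τ)
        (Alexander.regFlow (Torus.geometry d) ε (-(t - τ)) Z) = 0 := by
      intro τ
      rw [Alexander.regFlow_of_not_mem hZg]
      refine outBbgkyOp_eq_zero_of_not_mem N (fun Y hY => ?_) hZD
      simp only [hf]; exact transportedMarginal_eq_zero_of_not_mem _ _ τ hY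
    simp only [h1, h2, h3, integral_zero, add_zero]

end OneStep

/-! ## §3. (H1♯): the one-step hierarchy at the contact configurations, from (H1) -/

section Sharp

variable {ε : ℝ} (hε : 0 < ε) (hε' : ε < 2⁻¹) {N : ℕ} (W : Config N d (UnitAddTorus d) → ℝ)

/-- **The marginal as the tagged marginal of a transported datum**: for `s ≤ N`,
`f^{(s)}(t, W_s) = ∫ F_t(W_s, Z) dZ` with `F_t = transportedDatum F₀ t` on `Config (s + (N - s))`,
`F₀ = 1_{good} W` re-indexed (`nthMarginal_of_le` and the casts). [folklore] -/
theorem transportedMarginal_reg_eq_integral_transportedDatum {s : ℕ} (hs : s ≤ N) (t : ℝ)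
    (Ws : Config s d (UnitAddTorus d)) :
    transportedMarginal (fun n => Alexander.regHardSphereFlow (d := d) hε hε' n) W s t Ws =
      ∫ Zm : Config (N - s) d (UnitAddTorus d),
        transportedDatum (ε := ε) (s := s) (m := N - s)
          (fun z => (Alexander.good (Torus.geometry d) ε).indicator W
            (fun i => z (Fin.cast (Nat.add_sub_of_le hs).symm i)))
          t (Fin.append Ws Zm) := by
  haveI : SigmaFinite (volume : Measure (UnitAddTorus d × EuclideanSpace ℝ d)) := inferInstance
  rw [transportedMarginal_reg_apply, nthMarginal_of_le hs]
  simp only [marginal]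
  refine integral_congr_ae (Eventually.of_forall fun Zm => ?_)
  set z : Config (s + (N - s)) d (UnitAddTorus d) := Fin.append Ws Zm with hz
  simp only [transportedDatum]
  have hgood : ∀ y : Config (s + (N - s)) d (UnitAddTorus d),
      (fun i => y (Fin.cast (Nat.add_sub_of_le hs).symm i) : Config N d (UnitAddTorus d)) ∈
          Alexander.good (Torus.geometry d) ε ↔
        y ∈ Alexander.good (N := s + (N - s)) (Torus.geometry d) ε :=
    fun y => comp_cast_mem_good_iff (ε := ε) (Nat.add_sub_of_le hs).symm y
  by_cases hzg : z ∈ Alexander.good (N := s + (N - s)) (Torus.geometry d) ε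
  · have h1 : (fun i => z (Fin.cast (Nat.add_sub_of_le hs).symm i) : Config N d (UnitAddTorus d)) ∈
        Alexander.good (Torus.geometry d) ε := (hgood z).2 hzg
    have h2 : (fun i => Alexander.regFlow (Torus.geometry d) ε (-t) z (Fin.cast (Nat.add_sub_of_le hs).symm i) :
        Config N d (UnitAddTorus d)) ∈ Alexander.good (Torus.geometry d) ε :=
      (hgood _).2 (Alexander.mapsTo_regFlow_good hε hε' (-t) hzg)
    rw [indicator_of_mem h1, indicator_of_mem hzg, indicator_of_mem h2, regFlow_comp_cast]
  · rw [indicator_of_notMem (fun h => hzg ((hgood z).1 h)), indicator_of_notMem hzg]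

include hε hε' in
/-- The re-indexed datum `1_{good} W ∘ cast` is measurable. [folklore] -/
theorem measurable_topDatum_reg (hWm : Measurable W) {s : ℕ} (hs : s ≤ N) :
    Measurable fun z : Config (s + (N - s)) d (UnitAddTorus d) =>
      (Alexander.good (Torus.geometry d) ε).indicator W (fun i => z (Fin.cast (Nat.add_sub_of_le hs).symm i)) :=
  (hWm.indicator (Alexander.regHardSphereFlow (d := d) hε hε' N).measurableSet_good).comp (measurable_comp_cast _)

/-- The re-indexed datum `1_{good} W ∘ cast` has the Gaussian bound of `W`. [folklore] -/
theorem abs_topDatum_reg_le {C β : ℝ} (hC : 0 ≤ C) (hWb : ∀ z, |W z| ≤ C * Real.exp (-β * configEnergy z))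
    {s : ℕ} (hs : s ≤ N) (z : Config (s + (N - s)) d (UnitAddTorus d)) :
    |(Alexander.good (Torus.geometry d) ε).indicator W (fun i => z (Fin.cast (Nat.add_sub_of_le hs).symm i))| ≤
      C * Real.exp (-β * configEnergy z) := by
  by_cases hw : (fun i => z (Fin.cast (Nat.add_sub_of_le hs).symm i) : Config N d (UnitAddTorus d)) ∈
      Alexander.good (Torus.geometry d) ε
  · rw [indicator_of_mem hw]
    have h := hWb (fun i => z (Fin.cast (Nat.add_sub_of_le hs).symm i))
    rwa [configEnergy_comp_cast] at h
  · rw [indicator_of_notMem hw, abs_zero]; positivity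

include hε hε' in
/-- **The read of the collision term along the backward tagged orbit is bounded**:
`τ' ↦ (C_{S,S+1} f^{(S+1)}(τ'))(Φ^S_{-(τ-τ')} W_S)` is measurable and bounded by a constant
depending on `W_S` only (the weighted single-step estimate `op_weighted` with the uniform Gaussian
bound of the marginals, energy conservation and `‖v_i‖ ≤ √(2E)`).
[cite: BodineauGallagherSaintRaymondInvent2016, §4.3 (4.11) p. 12] -/
theorem abs_collisionRead_reg_le (hWm : Measurable W) {C β : ℝ} (hC : 0 ≤ C) (hβ : 0 < β)
    (hWb : ∀ z, |W z| ≤ C * Real.exp (-β * configEnergy z)) (S : ℕ) (τ : ℝ)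
    (WS : Config S d (UnitAddTorus d)) :
    ∃ L : ℝ, 0 ≤ L ∧
      (Measurable fun τ' : ℝ => (hsHierarchyModel (d := d) hε hε' N).op S
          (transportedMarginal (fun n => Alexander.regHardSphereFlow (d := d) hε hε' n) W (S + 1) τ')
          (Alexander.regFlow (Torus.geometry d) ε (-(τ - τ')) WS)) ∧
      ∀ τ' : ℝ, |(hsHierarchyModel (d := d) hε hε' N).op S
          (transportedMarginal (fun n => Alexander.regHardSphereFlow (d := d) hε hε' n) W (S + 1) τ')
          (Alexander.regFlow (Torus.geometry d) ε (-(τ - τ')) WS)| ≤ L := by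
  set M := hsHierarchyModel (d := d) hε hε' N with hM
  set K₀ : ℝ := C * ∫ Zm : Config (N - (S + 1)) d (UnitAddTorus d), Real.exp (-β * configEnergy Zm) with hK₀
  have hI0 : 0 ≤ ∫ Zm : Config (N - (S + 1)) d (UnitAddTorus d), Real.exp (-β * configEnergy Zm) :=
    integral_nonneg fun _ => (Real.exp_pos _).le
  have hK₀0 : 0 ≤ K₀ := by rw [hK₀]; positivity
  have hg : ∀ τ' Z, |transportedMarginal (fun n => Alexander.regHardSphereFlow (d := d) hε hε' n) W (S + 1) τ' Z| ≤
      K₀ * Real.exp (-β * configEnergy Z) :=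
    fun τ' Z => abs_transportedMarginal_reg_le hε hε' W hC hβ hWb (S + 1) τ' Z
  set V : ℝ := Real.sqrt (2 * configEnergy WS) with hV
  set L : ℝ := M.opConst * (Real.sqrt β ^ Fintype.card d)⁻¹ * (S * (Real.sqrt β)⁻¹ + S * V) *
    (K₀ * Real.exp (-β * configEnergy WS)) with hL
  have hL0 : 0 ≤ L := by
    rw [hL]
    have h1 : 0 ≤ M.opConst := M.opConst_nonneg
    positivity
  refine ⟨L, hL0, ?_, fun τ' => ?_⟩
  · -- measurability
    have hu := measurable_transportedMarginal_reg_uncurry hε hε' W hWm (S + 1)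
    have hop := M.measurable_op S hu
    have hcurve : Measurable fun τ' : ℝ => (τ', Alexander.regFlow (Torus.geometry d) ε (-(τ - τ')) WS) := by
      refine measurable_id.prodMk ?_
      have h2 : Measurable fun τ' : ℝ => ((-(τ - τ'), WS) : ℝ × Config S d (UnitAddTorus d)) :=
        ((measurable_const.sub measurable_id).neg).prodMk measurable_const
      have h := (Alexander.measurable_regFlow_uncurry (d := d) (N := S) (ε := ε) hε').comp h2
      exact h
    have h3 : Measurable ((fun p : ℝ × Config S d (UnitAddTorus d) =>
        M.op S (fun Z => transportedMarginal (fun n => Alexander.regHardSphereFlow (d := d) hε hε' n) W (S + 1) p.1 Z) p.2) ∘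
        (fun τ' : ℝ => (τ', Alexander.regFlow (Torus.geometry d) ε (-(τ - τ')) WS))) := hop.comp hcurve
    simpa only [Function.comp_def] using h3
  · have hw := M.op_weighted S (transportedMarginal (fun n => Alexander.regHardSphereFlow (d := d) hε hε' n) W (S + 1) τ')
      K₀ β hβ hK₀0 (hg τ') (Alexander.regFlow (Torus.geometry d) ε (-(τ - τ')) WS)
    rw [Alexander.configEnergy_regFlow] at hw
    refine hw.trans ?_
    rw [hL]
    have hsum : ∑ i, ‖(Alexander.regFlow (Torus.geometry d) ε (-(τ - τ')) WS i).2‖ ≤ S * V := by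
      have h1 : ∀ i, ‖(Alexander.regFlow (Torus.geometry d) ε (-(τ - τ')) WS i).2‖ ≤ V := by
        intro i
        have h := norm_vel_le_sqrt_configEnergy (Alexander.regFlow (Torus.geometry d) ε (-(τ - τ')) WS) i
        rwa [Alexander.configEnergy_regFlow] at h
      calc ∑ i, ‖(Alexander.regFlow (Torus.geometry d) ε (-(τ - τ')) WS i).2‖ ≤ ∑ _i : Fin S, V :=
            Finset.sum_le_sum fun i _ => h1 i
        _ = S * V := by rw [Finset.sum_const, Finset.card_univ, Fintype.card_fin, nsmul_eq_mul]
    have h1 : 0 ≤ M.opConst := M.opConst_nonneg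
    have h2 : 0 ≤ M.opConst * (Real.sqrt β ^ Fintype.card d)⁻¹ := by positivity
    have h3 : 0 ≤ K₀ * Real.exp (-β * configEnergy WS) := by positivity
    gcongr

include hε hε' in
/-- **The core of (H1♯) from (H1)** for the marginals of a transported datum. Fix the level
`k + 1 ≤ N`, a measurable family of tagged configurations `W♯(Z', q) ∈ Config (k+1)` indexed by the
collision parameters, a measurable parameter condition `cond`, and assume: the transported family
`((u, Z'), q) ↦ Φ_{-u} W♯(Z', q)` is quasi-measure-preserving on `{u > 0} ∩ cond` (the pull-back
property `gainPullback` / `lossPullback`), `W♯` is good for a.e. admissible parameter, and the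
one-step hierarchy (H1) holds at level `k + 1` for a.e. configuration at every time `t ≥ 0`. Then
the one-step hierarchy holds AT `W♯(Z', q)` at time `τ`, for a.e. `((τ, Z'), q)` with `τ > 0` and
`cond` (`eq_of_ae_approx` with the pulled-back (H1), the short-time decoupling estimate
`abs_marginal_backward_sub_le` and the Lipschitz bound of the collision integral).
[cite: BodineauGallagherSaintRaymondInvent2016, §3.1 Remark 3.1 p. 9] -/
theorem contactTrace_reg_core (hWm : Measurable W) {C β : ℝ} (hC : 0 ≤ C) (hβ : 0 < β)
    (hWb : ∀ z, |W z| ≤ C * Real.exp (-β * configEnergy z)) {k : ℕ} (hS : k + 1 ≤ N)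
    {cond : Config k d (UnitAddTorus d) × (sphere (0 : EuclideanSpace ℝ d) 1 × EuclideanSpace ℝ d) → Prop}
    (hcondm : MeasurableSet {x | cond x})
    {Wsh : Config k d (UnitAddTorus d) × (sphere (0 : EuclideanSpace ℝ d) 1 × EuclideanSpace ℝ d) →
      Config (k + 1) d (UnitAddTorus d)} (hWshm : Measurable Wsh)
    (hΛ : QuasiMeasurePreserving
      (fun p : (ℝ × Config k d (UnitAddTorus d)) × (sphere (0 : EuclideanSpace ℝ d) 1 × EuclideanSpace ℝ d) =>
        Alexander.regFlow (Torus.geometry d) ε (-p.1.1) (Wsh (p.1.2, p.2)))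
      ((((volume : Measure ℝ).prod (volume : Measure (Config k d (UnitAddTorus d)))).prod
        ((sphereMeasure (E := EuclideanSpace ℝ d)).prod (volume : Measure (EuclideanSpace ℝ d)))).restrict
        {p | 0 < p.1.1 ∧ cond (p.1.2, p.2)}) volume)
    (hgood : ∀ᵐ Z' : Config k d (UnitAddTorus d), ∀ᵐ q : sphere (0 : EuclideanSpace ℝ d) 1 × EuclideanSpace ℝ d
        ∂((sphereMeasure (E := EuclideanSpace ℝ d)).prod volume), cond (Z', q) →
        Wsh (Z', q) ∈ Alexander.good (N := k + 1) (Torus.geometry d) ε)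
    (hH1 : ∀ t : ℝ, 0 ≤ t → ∀ᵐ Z : Config (k + 1) d (UnitAddTorus d),
      transportedMarginal (fun n => Alexander.regHardSphereFlow (d := d) hε hε' n) W (k + 1) t Z =
        (hsHierarchyModel (d := d) hε hε' N).transport (k + 1) t
            (transportedMarginal (fun n => Alexander.regHardSphereFlow (d := d) hε hε' n) W (k + 1) 0) Z +
          ∫ τ' in (0 : ℝ)..t, (hsHierarchyModel (d := d) hε hε' N).transport (k + 1) (t - τ')
            ((hsHierarchyModel (d := d) hε hε' N).op (k + 1)
              (transportedMarginal (fun n => Alexander.regHardSphereFlow (d := d) hε hε' n) W (k + 1 + 1) τ')) Z) :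
    ∀ᵐ p : (ℝ × Config k d (UnitAddTorus d)) × (sphere (0 : EuclideanSpace ℝ d) 1 × EuclideanSpace ℝ d)
        ∂(((volume : Measure ℝ).prod (volume : Measure (Config k d (UnitAddTorus d)))).prod
          ((sphereMeasure (E := EuclideanSpace ℝ d)).prod (volume : Measure (EuclideanSpace ℝ d)))),
      0 < p.1.1 → cond (p.1.2, p.2) →
        transportedMarginal (fun n => Alexander.regHardSphereFlow (d := d) hε hε' n) W (k + 1) p.1.1 (Wsh (p.1.2, p.2)) =
          (hsHierarchyModel (d := d) hε hε' N).transport (k + 1) p.1.1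
              (transportedMarginal (fun n => Alexander.regHardSphereFlow (d := d) hε hε' n) W (k + 1) 0)
              (Wsh (p.1.2, p.2)) +
            ∫ τ' in (0 : ℝ)..p.1.1, (hsHierarchyModel (d := d) hε hε' N).transport (k + 1) (p.1.1 - τ')
              ((hsHierarchyModel (d := d) hε hε' N).op (k + 1)
                (transportedMarginal (fun n => Alexander.regHardSphereFlow (d := d) hε hε' n) W (k + 1 + 1) τ'))
              (Wsh (p.1.2, p.2)) := by
  classical
  haveI : IsFiniteMeasure (sphereMeasure (E := EuclideanSpace ℝ d)) :=
    Literature.Analysis.FluidPDE.isFiniteMeasure_sphereMeasure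
  haveI : SigmaFinite (volume : Measure (UnitAddTorus d × EuclideanSpace ℝ d)) := inferInstance
  set M := hsHierarchyModel (d := d) hε hε' N with hM
  set f := transportedMarginal (fun n => Alexander.regHardSphereFlow (d := d) hε hε' n) W with hf
  set μQ : Measure (sphere (0 : EuclideanSpace ℝ d) 1 × EuclideanSpace ℝ d) :=
    (sphereMeasure (E := EuclideanSpace ℝ d)).prod volume with hμQ
  haveI : SFinite μQ := by rw [hμQ]; infer_instance
  -- the datum on `Config ((k+1) + (N-(k+1)))` and the decoupling constant
  set F₀ : Config (k + 1 + (N - (k + 1))) d (UnitAddTorus d) → ℝ := fun z =>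
    (Alexander.good (Torus.geometry d) ε).indicator W (fun i => z (Fin.cast (Nat.add_sub_of_le hS).symm i)) with hF₀
  have hF₀m : Measurable F₀ := measurable_topDatum_reg hε hε' W hWm hS
  have hF₀b : ∀ z, |F₀ z| ≤ C * Real.exp (-β * configEnergy z) := fun z =>
    abs_topDatum_reg_le W hC hWb hS z
  obtain ⟨A, hA0, hTr⟩ := abs_marginal_backward_sub_le hε hε' (s := k + 1) (m := N - (k + 1)) F₀ hβ hC hF₀m hF₀b
  have hbr : ∀ (t : ℝ) (Wc : Config (k + 1) d (UnitAddTorus d)), f (k + 1) t Wc =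
      ∫ Zm : Config (N - (k + 1)) d (UnitAddTorus d), transportedDatum (ε := ε) F₀ t (Fin.append Wc Zm) :=
    fun t Wc => transportedMarginal_reg_eq_integral_transportedDatum hε hε' W hS t Wc
  have hfT : ∀ (k' : ℕ) (T : ℝ), IsNiceT T (f k') := fun k' T =>
    isNiceT_transportedMarginal_reg hε hε' W hWm hC hβ hWb k' T
  -- the two sides of (H1) as functions of `(t, Z)`
  set K₁ : ℝ × Config (k + 1) d (UnitAddTorus d) → ℝ := fun y => f (k + 1) y.1 y.2 with hK₁
  set K₂ : ℝ × Config (k + 1) d (UnitAddTorus d) → ℝ := fun y =>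
    M.transport (k + 1) y.1 (f (k + 1) 0) y.2 + M.remainderTerm f 1 (k + 1) y.1 y.2 with hK₂
  have hK₁m : Measurable K₁ := measurable_transportedMarginal_reg_uncurry hε hε' W hWm (k + 1)
  have hK₂m : Measurable K₂ := by
    have h1 : Measurable fun y : ℝ × Config (k + 1) d (UnitAddTorus d) =>
        f (k + 1) 0 (Alexander.regFlow (Torus.geometry d) ε (-y.1) y.2) := by
      have h2 : Measurable fun y : ℝ × Config (k + 1) d (UnitAddTorus d) => ((-y.1, y.2) : ℝ × Config (k + 1) d (UnitAddTorus d)) :=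
        measurable_fst.neg.prodMk measurable_snd
      have h := (Alexander.measurable_regFlow_uncurry (d := d) (N := k + 1) (ε := ε) hε').comp h2
      exact (measurable_transportedMarginal_reg hε hε' W hWm (k + 1) 0).comp h
    exact h1.add (HierarchyModel.isNiceT_remainderTerm M hfT 1 (k + 1) 0).measurable
  -- (H1) as a product-a.e. statement
  have ih : ∀ᵐ y : ℝ × Config (k + 1) d (UnitAddTorus d) ∂((volume : Measure ℝ).prod volume), 0 < y.1 → K₁ y = K₂ y := by
    have hE : MeasurableSet {y : ℝ × Config (k + 1) d (UnitAddTorus d) | 0 < y.1 ∧ K₁ y ≠ K₂ y} :=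
      (measurableSet_lt measurable_const measurable_fst).inter (measurableSet_eq_fun hK₁m hK₂m).compl
    have h0 : ((volume : Measure ℝ).prod (volume : Measure (Config (k + 1) d (UnitAddTorus d))))
        {y | 0 < y.1 ∧ K₁ y ≠ K₂ y} = 0 := by
      rw [Measure.measure_prod_null hE]
      refine Eventually.of_forall fun t => ?_
      show volume (Prod.mk t ⁻¹' {y : ℝ × Config (k + 1) d (UnitAddTorus d) | 0 < y.1 ∧ K₁ y ≠ K₂ y}) = 0
      rcases le_or_gt t 0 with ht | ht
      · have : Prod.mk t ⁻¹' {y : ℝ × Config (k + 1) d (UnitAddTorus d) | 0 < y.1 ∧ K₁ y ≠ K₂ y} = ∅ := by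
          ext Z
          simp only [mem_preimage, mem_setOf_eq, mem_empty_iff_false, iff_false, not_and]
          intro h; linarith
        rw [this, measure_empty]
      · refine measure_mono_null (fun Z hZ => ?_) (ae_iff.1 (hH1 t ht.le))
        exact hZ.2
    filter_upwards [measure_eq_zero_iff_ae_notMem.1 h0] with y hy ht
    by_contra hne
    exact hy ⟨ht, hne⟩
  -- measurability of the parameter set
  have hSm : MeasurableSet {p : (ℝ × Config k d (UnitAddTorus d)) × (sphere (0 : EuclideanSpace ℝ d) 1 × EuclideanSpace ℝ d) |
      0 < p.1.1 ∧ cond (p.1.2, p.2)} :=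
    (measurableSet_lt measurable_const measurable_fst.fst).inter
      ((measurable_fst.snd.prodMk measurable_snd) hcondm)
  -- transfer of (H1)
  have hT1 := ae_transfer_along_pullback (K₁ := K₁) (K₂ := K₂) ih hSm hΛ
  -- transfer of the good-fibre property
  set KF : ℝ × Config (k + 1) d (UnitAddTorus d) → ℝ := fun y =>
    if (∀ᵐ Zm : Config (N - (k + 1)) d (UnitAddTorus d),
        Fin.append y.2 Zm ∈ hardSphereDomain (Torus.geometry d) (k + 1 + (N - (k + 1))) ε →
        Fin.append y.2 Zm ∈ Alexander.good (N := k + 1 + (N - (k + 1))) (Torus.geometry d) ε) then 0 else 1 with hKF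
  have ihF : ∀ᵐ y : ℝ × Config (k + 1) d (UnitAddTorus d) ∂((volume : Measure ℝ).prod volume),
      0 < y.1 → KF y = (fun _ => (0 : ℝ)) y := by
    have h := ae_ae_append_mem_good (d := d) hε hε' (k + 1) (N - (k + 1))
    have h2 : ∀ᵐ y : ℝ × Config (k + 1) d (UnitAddTorus d) ∂((volume : Measure ℝ).prod volume),
        ∀ᵐ Zm : Config (N - (k + 1)) d (UnitAddTorus d),
          Fin.append y.2 Zm ∈ hardSphereDomain (Torus.geometry d) (k + 1 + (N - (k + 1))) ε →
          Fin.append y.2 Zm ∈ Alexander.good (N := k + 1 + (N - (k + 1))) (Torus.geometry d) ε :=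
      (Measure.quasiMeasurePreserving_snd (μ := (volume : Measure ℝ))
        (ν := (volume : Measure (Config (k + 1) d (UnitAddTorus d))))).ae h
    filter_upwards [h2] with y hy _
    simp only [hKF, if_pos hy]
  have hT2 := ae_transfer_along_pullback (K₁ := KF) (K₂ := fun _ => (0 : ℝ)) ihF hSm hΛ
  -- goodness of `W♯`, lifted to the parameters
  have hT3 : ∀ᵐ y : ℝ × Config k d (UnitAddTorus d) ∂((volume : Measure ℝ).prod volume),
      ∀ᵐ q : sphere (0 : EuclideanSpace ℝ d) 1 × EuclideanSpace ℝ d ∂μQ, cond (y.2, q) →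
        Wsh (y.2, q) ∈ Alexander.good (N := k + 1) (Torus.geometry d) ε :=
    (Measure.quasiMeasurePreserving_snd (μ := (volume : Measure ℝ))
      (ν := (volume : Measure (Config k d (UnitAddTorus d))))).ae hgood
  -- the identity, parameter by parameter
  have hmain : ∀ᵐ y : ℝ × Config k d (UnitAddTorus d) ∂((volume : Measure ℝ).prod volume),
      ∀ᵐ q : sphere (0 : EuclideanSpace ℝ d) 1 × EuclideanSpace ℝ d ∂μQ, 0 < y.1 → cond (y.2, q) →
        f (k + 1) y.1 (Wsh (y.2, q)) = M.transport (k + 1) y.1 (f (k + 1) 0) (Wsh (y.2, q)) +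
          ∫ τ' in (0 : ℝ)..y.1, M.transport (k + 1) (y.1 - τ') (M.op (k + 1) (f (k + 1 + 1) τ')) (Wsh (y.2, q)) := by
    filter_upwards [hT1, hT2, hT3] with y h1 h2 h3
    filter_upwards [h1, h2, h3] with q h1q h2q h3q hτ hc
    set Wc := Wsh (y.2, q) with hWc
    have hWg : Wc ∈ Alexander.good (N := k + 1) (Torus.geometry d) ε := h3q hc
    have hflow : ∀ a b : ℝ, Alexander.regFlow (Torus.geometry d) ε a (Alexander.regFlow (Torus.geometry d) ε b Wc) =
        Alexander.regFlow (Torus.geometry d) ε (a + b) Wc := fun a b => (Alexander.regFlow_add hε hε' a b Wc).symm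
    obtain ⟨L, hL0, hKm, hKb⟩ := abs_collisionRead_reg_le hε hε' W hWm hC hβ hWb (k + 1) y.1 Wc
    -- the collision integral along the backward orbit and its Lipschitz bound
    set Kf : ℝ → ℝ := fun τ' => (M.op (k + 1) (f (k + 1 + 1) τ'))
      (Alexander.regFlow (Torus.geometry d) ε (-(y.1 - τ')) Wc) with hKf
    set P : ℝ → ℝ := fun t => ∫ τ' in (0 : ℝ)..t, Kf τ' with hP
    have hKb' : ∀ τ', ‖Kf τ'‖ ≤ L := fun τ' => by rw [Real.norm_eq_abs]; exact hKb τ'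
    have hKi : ∀ a b : ℝ, IntervalIntegrable Kf volume a b := fun a b =>
      (intervalIntegrable_const (c := L)).mono_fun' hKm.aestronglyMeasurable (Eventually.of_forall fun τ' => hKb' τ')
    have h3' : ∀ t ∈ Ioo 0 y.1, |P t - P y.1| ≤ L * (y.1 - t) := by
      intro t ht
      have hsub : P t - P y.1 = ∫ τ' in y.1..t, Kf τ' := by
        simp only [hP]
        exact intervalIntegral.integral_interval_sub_left (hKi 0 t) (hKi 0 y.1)
      rw [hsub]
      have h := intervalIntegral.norm_integral_le_of_norm_le_const (a := y.1) (b := t) (C := L) (f := Kf)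
        fun x _ => hKb' x
      rw [Real.norm_eq_abs, show |t - y.1| = y.1 - t by rw [abs_sub_comm]; exact abs_of_nonneg (by linarith [ht.2])] at h
      exact h
    -- (H1) along the backward orbit
    have h1' : ∀ᵐ t : ℝ, t ∈ Ioo 0 y.1 →
        f (k + 1) t (Alexander.regFlow (Torus.geometry d) ε (-(y.1 - t)) Wc) =
          f (k + 1) 0 (Alexander.regFlow (Torus.geometry d) ε (-y.1) Wc) + P t := by
      filter_upwards [h1q] with t h1t ht
      have hmem : ((y.1 - t, y.2), q) ∈ {p : (ℝ × Config k d (UnitAddTorus d)) × (sphere (0 : EuclideanSpace ℝ d) 1 × EuclideanSpace ℝ d) |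
          0 < p.1.1 ∧ cond (p.1.2, p.2)} := ⟨by show 0 < y.1 - t; linarith [ht.2], hc⟩
      have h := h1t hmem ht.1
      change f (k + 1) t (Alexander.regFlow (Torus.geometry d) ε (-(y.1 - t)) Wc) =
        M.transport (k + 1) t (f (k + 1) 0) (Alexander.regFlow (Torus.geometry d) ε (-(y.1 - t)) Wc) +
          M.remainderTerm f 1 (k + 1) t (Alexander.regFlow (Torus.geometry d) ε (-(y.1 - t)) Wc) at h
      rw [h, HierarchyModel.remainderTerm_one]
      simp only [hM, hsHierarchyModel_transport_apply]
      rw [hflow, show -t + -(y.1 - t) = -y.1 by ring]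
      congr 1
      refine intervalIntegral.integral_congr fun τ' _ => ?_
      simp only [hKf, hM, hflow]
      congr 2
      ring
    -- the modulus from the decoupling estimate
    have h2' : ∀ᵐ t : ℝ, t ∈ Ioo 0 y.1 →
        |f (k + 1) t (Alexander.regFlow (Torus.geometry d) ε (-(y.1 - t)) Wc) - f (k + 1) y.1 Wc| ≤
          (2 * C * A * Real.exp (-(β / 2) * configEnergy Wc)) * (y.1 - t) := by
      filter_upwards [h2q] with t h2t ht
      have hmem : ((y.1 - t, y.2), q) ∈ {p : (ℝ × Config k d (UnitAddTorus d)) × (sphere (0 : EuclideanSpace ℝ d) 1 × EuclideanSpace ℝ d) |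
          0 < p.1.1 ∧ cond (p.1.2, p.2)} := ⟨by show 0 < y.1 - t; linarith [ht.2], hc⟩
      have hF := h2t hmem ht.1
      have hfib : ∀ᵐ Zm : Config (N - (k + 1)) d (UnitAddTorus d),
          Fin.append (Alexander.regFlow (Torus.geometry d) ε (-(y.1 - t)) Wc) Zm ∈
              hardSphereDomain (Torus.geometry d) (k + 1 + (N - (k + 1))) ε →
            Fin.append (Alexander.regFlow (Torus.geometry d) ε (-(y.1 - t)) Wc) Zm ∈
              Alexander.good (N := k + 1 + (N - (k + 1))) (Torus.geometry d) ε := by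
        by_contra hno
        have h1 : KF (t, Alexander.regFlow (Torus.geometry d) ε (-(y.1 - t)) Wc) = 1 := by
          simp only [hKF]
          rw [if_neg hno]
        have h2 : KF (t, Alexander.regFlow (Torus.geometry d) ε (-(y.1 - t)) Wc) = 0 := hF
        rw [h1] at h2
        exact one_ne_zero h2
      have hT := hTr y.1 (u := y.1 - t) (by linarith [ht.2]) hWg hfib
      rw [show y.1 - (y.1 - t) = t by ring, ← hbr, ← hbr] at hT
      calc |f (k + 1) t (Alexander.regFlow (Torus.geometry d) ε (-(y.1 - t)) Wc) - f (k + 1) y.1 Wc|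
          ≤ 2 * C * A * (y.1 - t) * Real.exp (-(β / 2) * configEnergy Wc) := hT
        _ = (2 * C * A * Real.exp (-(β / 2) * configEnergy Wc)) * (y.1 - t) := by ring
    have hfinal := eq_of_ae_approx (φ := fun t => f (k + 1) t (Alexander.regFlow (Torus.geometry d) ε (-(y.1 - t)) Wc))
      (P := P) (a := f (k + 1) y.1 Wc) (c := f (k + 1) 0 (Alexander.regFlow (Torus.geometry d) ε (-y.1) Wc)) hτ h1' h2' h3'
    rw [hfinal]
    simp only [hP, hKf, hM, hsHierarchyModel_transport_apply]
  -- back to the product measure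
  have hL : Measurable fun p : (ℝ × Config k d (UnitAddTorus d)) × (sphere (0 : EuclideanSpace ℝ d) 1 × EuclideanSpace ℝ d) =>
      K₁ (p.1.1, Wsh (p.1.2, p.2)) :=
    hK₁m.comp (measurable_fst.fst.prodMk (hWshm.comp (measurable_fst.snd.prodMk measurable_snd)))
  have hRm : Measurable fun p : (ℝ × Config k d (UnitAddTorus d)) × (sphere (0 : EuclideanSpace ℝ d) 1 × EuclideanSpace ℝ d) =>
      K₂ (p.1.1, Wsh (p.1.2, p.2)) :=
    hK₂m.comp (measurable_fst.fst.prodMk (hWshm.comp (measurable_fst.snd.prodMk measurable_snd)))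
  have hset : MeasurableSet {p : (ℝ × Config k d (UnitAddTorus d)) × (sphere (0 : EuclideanSpace ℝ d) 1 × EuclideanSpace ℝ d) |
      0 < p.1.1 → cond (p.1.2, p.2) →
        f (k + 1) p.1.1 (Wsh (p.1.2, p.2)) = M.transport (k + 1) p.1.1 (f (k + 1) 0) (Wsh (p.1.2, p.2)) +
          ∫ τ' in (0 : ℝ)..p.1.1, M.transport (k + 1) (p.1.1 - τ') (M.op (k + 1) (f (k + 1 + 1) τ')) (Wsh (p.1.2, p.2))} := by
    have heq : {p : (ℝ × Config k d (UnitAddTorus d)) × (sphere (0 : EuclideanSpace ℝ d) 1 × EuclideanSpace ℝ d) |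
        0 < p.1.1 → cond (p.1.2, p.2) →
          f (k + 1) p.1.1 (Wsh (p.1.2, p.2)) = M.transport (k + 1) p.1.1 (f (k + 1) 0) (Wsh (p.1.2, p.2)) +
            ∫ τ' in (0 : ℝ)..p.1.1, M.transport (k + 1) (p.1.1 - τ') (M.op (k + 1) (f (k + 1 + 1) τ')) (Wsh (p.1.2, p.2))} =
        {p | 0 < p.1.1 ∧ cond (p.1.2, p.2)}ᶜ ∪ {p | K₁ (p.1.1, Wsh (p.1.2, p.2)) = K₂ (p.1.1, Wsh (p.1.2, p.2))} := by
      ext p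
      simp only [mem_setOf_eq, mem_union, mem_compl_iff, not_and, hK₁, hK₂, HierarchyModel.remainderTerm_one]
      tauto
    rw [heq]
    exact hSm.compl.union (measurableSet_eq_fun hL hRm)
  exact (Measure.ae_prod_iff_ae_ae hset).2 hmain

include hε hε' in
/-- **(H1♯) from (H1)** for the marginals of a transported symmetric Gaussian-bounded datum
(`d ≥ 2`, `0 < ε < 1/2`): if the one-step integrated hierarchy holds for a.e. configuration at every
`t ≥ 0` and every level, then it holds at the outgoing contact configurations
`outRep(gainConfig)` / `outRep(lossConfig)` read by the collision operator, for a.e. collision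
parameter (`contactTrace_reg_core` with `gainPullback` / `lossPullback` and the flux-a.e. goodness
`ae_regularityClause`; levels above `N` vanish). This is the hypothesis `hH` of
`hs_seriesFamily_ae_eq_of_oneStep`. [cite: BodineauGallagherSaintRaymondInvent2016, §3.1 Remark 3.1 p. 9] -/
theorem transportedMarginal_oneStep_sharp (hd : 2 ≤ Fintype.card d) (hWm : Measurable W) {C β : ℝ}
    (hC : 0 ≤ C) (hβ : 0 < β) (hWb : ∀ z, |W z| ≤ C * Real.exp (-β * configEnergy z))
    (hH1 : ∀ (k : ℕ) (t : ℝ), 0 ≤ t → ∀ᵐ Z : Config k d (UnitAddTorus d),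
      transportedMarginal (fun n => Alexander.regHardSphereFlow (d := d) hε hε' n) W k t Z =
        (hsHierarchyModel (d := d) hε hε' N).transport k t
            (transportedMarginal (fun n => Alexander.regHardSphereFlow (d := d) hε hε' n) W k 0) Z +
          ∫ τ in (0 : ℝ)..t, (hsHierarchyModel (d := d) hε hε' N).transport k (t - τ)
            ((hsHierarchyModel (d := d) hε hε' N).op k
              (transportedMarginal (fun n => Alexander.regHardSphereFlow (d := d) hε hε' n) W (k + 1) τ)) Z)
    (k : ℕ) (i : Fin k) :
    ∀ᵐ p : (ℝ × Config k d (UnitAddTorus d)) × (sphere (0 : EuclideanSpace ℝ d) 1 × EuclideanSpace ℝ d)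
        ∂(((volume : Measure ℝ).prod (volume : Measure (Config k d (UnitAddTorus d)))).prod
          ((sphereMeasure (E := EuclideanSpace ℝ d)).prod (volume : Measure (EuclideanSpace ℝ d)))),
      (0 < p.1.1 → 0 < ⟪(p.2.1 : EuclideanSpace ℝ d), p.2.2 - (p.1.2 i).2⟫_ℝ →
        gainConfig (Torus.geometry d) ε p.1.2 i p.2.1 p.2.2 ∈ hardSphereDomain (Torus.geometry d) (k + 1) ε →
        transportedMarginal (fun n => Alexander.regHardSphereFlow (d := d) hε hε' n) W (k + 1) p.1.1
            (outRep (Torus.geometry d) k i (gainConfig (Torus.geometry d) ε p.1.2 i p.2.1 p.2.2)) =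
          (hsHierarchyModel (d := d) hε hε' N).transport (k + 1) p.1.1
              (transportedMarginal (fun n => Alexander.regHardSphereFlow (d := d) hε hε' n) W (k + 1) 0)
              (outRep (Torus.geometry d) k i (gainConfig (Torus.geometry d) ε p.1.2 i p.2.1 p.2.2)) +
            ∫ τ' in (0 : ℝ)..p.1.1, (hsHierarchyModel (d := d) hε hε' N).transport (k + 1) (p.1.1 - τ')
              ((hsHierarchyModel (d := d) hε hε' N).op (k + 1)
                (transportedMarginal (fun n => Alexander.regHardSphereFlow (d := d) hε hε' n) W (k + 1 + 1) τ'))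
              (outRep (Torus.geometry d) k i (gainConfig (Torus.geometry d) ε p.1.2 i p.2.1 p.2.2))) ∧
      (0 < p.1.1 → ⟪(p.2.1 : EuclideanSpace ℝ d), p.2.2 - (p.1.2 i).2⟫_ℝ < 0 →
        lossConfig (Torus.geometry d) ε p.1.2 i p.2.1 p.2.2 ∈ hardSphereDomain (Torus.geometry d) (k + 1) ε →
        transportedMarginal (fun n => Alexander.regHardSphereFlow (d := d) hε hε' n) W (k + 1) p.1.1
            (outRep (Torus.geometry d) k i (lossConfig (Torus.geometry d) ε p.1.2 i p.2.1 p.2.2)) =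
          (hsHierarchyModel (d := d) hε hε' N).transport (k + 1) p.1.1
              (transportedMarginal (fun n => Alexander.regHardSphereFlow (d := d) hε hε' n) W (k + 1) 0)
              (outRep (Torus.geometry d) k i (lossConfig (Torus.geometry d) ε p.1.2 i p.2.1 p.2.2)) +
            ∫ τ' in (0 : ℝ)..p.1.1, (hsHierarchyModel (d := d) hε hε' N).transport (k + 1) (p.1.1 - τ')
              ((hsHierarchyModel (d := d) hε hε' N).op (k + 1)
                (transportedMarginal (fun n => Alexander.regHardSphereFlow (d := d) hε hε' n) W (k + 1 + 1) τ'))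
              (outRep (Torus.geometry d) k i (lossConfig (Torus.geometry d) ε p.1.2 i p.2.1 p.2.2))) := by
  haveI : IsFiniteMeasure (sphereMeasure (E := EuclideanSpace ℝ d)) :=
    Literature.Analysis.FluidPDE.isFiniteMeasure_sphereMeasure
  -- levels above `N`: everything vanishes
  rcases le_or_gt (k + 1) N with hS | hS
  swap
  · have h0 : ∀ t, transportedMarginal (fun n => Alexander.regHardSphereFlow (d := d) hε hε' n) W (k + 1) t = 0 :=
      transportedMarginal_reg_eq_zero_of_lt hε hε' W hS
    have h1 : ∀ t, transportedMarginal (fun n => Alexander.regHardSphereFlow (d := d) hε hε' n) W (k + 1 + 1) t = 0 :=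
      transportedMarginal_reg_eq_zero_of_lt hε hε' W (by omega)
    refine Eventually.of_forall fun p => ⟨fun _ _ _ => ?_, fun _ _ _ => ?_⟩ <;>
    · simp only [h0, h1, Pi.zero_apply, HierarchyModel.op_zero, hsHierarchyModel_transport_apply,
        intervalIntegral.integral_zero, add_zero]
  -- the level `k + 1 ≤ N`: `k = m + 1`
  cases k with
  | zero => exact i.elim0
  | succ m =>
    have hIH : ∀ (k' : ℕ) (h : ℝ), ∀ᵐ Wc : Config k' d (UnitAddTorus d), bgsrRegular ε 0 k' h Wc :=
      fun k' h => Eventually.of_forall fun Wc => trivial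
    have hreg := ae_regularityClause hε hε' hd hIH i 0
    have hG := contactTrace_reg_core hε hε' W hWm hC hβ hWb hS
      (cond := fun x => 0 < ⟪(x.2.1 : EuclideanSpace ℝ d), x.2.2 - (x.1 i).2⟫_ℝ ∧
        gainConfig (Torus.geometry d) ε x.1 i x.2.1 x.2.2 ∈ hardSphereDomain (Torus.geometry d) (m + 1 + 1) ε)
      (measurableSet_gainCond (ε := ε) i)
      (Wsh := fun x => outRep (Torus.geometry d) (m + 1) i (gainConfig (Torus.geometry d) ε x.1 i x.2.1 x.2.2))
      (measurable_outRep_gainConfig (ε := ε) i) (gainPullback hε hε' hd (m + 1) i)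
      (hreg.mono fun Z' h => h.mono fun q hq hc => (hq.1 hc.1 hc.2).1) (hH1 (m + 1 + 1))
    have hL := contactTrace_reg_core hε hε' W hWm hC hβ hWb hS
      (cond := fun x => ⟪(x.2.1 : EuclideanSpace ℝ d), x.2.2 - (x.1 i).2⟫_ℝ < 0 ∧
        lossConfig (Torus.geometry d) ε x.1 i x.2.1 x.2.2 ∈ hardSphereDomain (Torus.geometry d) (m + 1 + 1) ε)
      (measurableSet_lossCond (ε := ε) i)
      (Wsh := fun x => outRep (Torus.geometry d) (m + 1) i (lossConfig (Torus.geometry d) ε x.1 i x.2.1 x.2.2))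
      (measurable_outRep_lossConfig (ε := ε) i) (lossPullback hε hε' hd (m + 1) i)
      (hreg.mono fun Z' h => h.mono fun q hq hc => (hq.2 hc.1 hc.2).1) (hH1 (m + 1 + 1))
    filter_upwards [hG, hL] with p hGp hLp
    exact ⟨fun hτ hb hD => hGp hτ ⟨hb, hD⟩, fun hτ hb hD => hLp hτ ⟨hb, hD⟩⟩

end Sharp

/-! ## §4. (S): the iterated Duhamel formula almost everywhere -/

section Series

variable {ε : ℝ} (hε : 0 < ε) (hε' : ε < 2⁻¹) {N : ℕ} (W : Config N d (UnitAddTorus d) → ℝ)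

include hε hε' in
/-- **(S) for the marginals of a transported symmetric Gaussian-bounded datum** (CIP 1994 (4.7)
"for almost all `z^s`"; GST 2013 (4.3.7)–(4.3.8) integrated): for `d ≥ 2`, `0 < ε < 1/2`, a
measurable permutation-symmetric `W` on `Config N` with `|W| ≤ C e^{-βE}` (`β > 0`), every level `s`
and every `t ≥ 0`, the finite Duhamel series of the `N`-sphere model started from the time-`0`
marginals is a version of the marginal at time `t`:
`(hsHierarchyModel hε hε' N).seriesFamily N (f · 0) s t = f^{(s)}(t)` Lebesgue-a.e.
(`hs_seriesFamily_ae_eq_of_oneStep` fed with (H1) `transportedMarginal_oneStep` and (H1♯)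
`transportedMarginal_oneStep_sharp`). [cite: CIP1994, §4.3 Thm 4.3.1 and §4.4 (4.7)] -/
theorem seriesFamily_ae_eq_transportedMarginal [DecidableEq d] (hd : 2 ≤ Fintype.card d) (hWm : Measurable W)
    (hWσ : ∀ (σ : Equiv.Perm (Fin N)) (z : Config N d (UnitAddTorus d)),
      W (z ∘ σ : Config N d (UnitAddTorus d)) = W z)
    {C β : ℝ} (hC : 0 ≤ C) (hβ : 0 < β) (hWb : ∀ z, |W z| ≤ C * Real.exp (-β * configEnergy z))
    (s : ℕ) {t : ℝ} (ht : 0 ≤ t) :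
    (hsHierarchyModel (d := d) hε hε' N).seriesFamily N
        (fun a => transportedMarginal (fun n => Alexander.regHardSphereFlow (d := d) hε hε' n) W a 0) s t =ᵐ[volume]
      transportedMarginal (fun n => Alexander.regHardSphereFlow (d := d) hε hε' n) W s t :=
  have hH1 : ∀ (k : ℕ) (t : ℝ), 0 ≤ t → ∀ᵐ Z : Config k d (UnitAddTorus d),
      transportedMarginal (fun n => Alexander.regHardSphereFlow (d := d) hε hε' n) W k t Z =
        (hsHierarchyModel (d := d) hε hε' N).transport k t
            (transportedMarginal (fun n => Alexander.regHardSphereFlow (d := d) hε hε' n) W k 0) Z +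
          ∫ τ in (0 : ℝ)..t, (hsHierarchyModel (d := d) hε hε' N).transport k (t - τ)
            ((hsHierarchyModel (d := d) hε hε' N).op k
              (transportedMarginal (fun n => Alexander.regHardSphereFlow (d := d) hε hε' n) W (k + 1) τ)) Z :=
    fun k _ ht => transportedMarginal_oneStep hε hε' W hd hWm hWσ hC hβ hWb k ht
  hs_seriesFamily_ae_eq_of_oneStep hε hε' N (gainPullback hε hε' hd) (lossPullback hε hε' hd) (Nmax := N)
    (fun k T => isNiceT_transportedMarginal_reg hε hε' W hWm hC hβ hWb k T)
    (fun _ t _ hZ => transportedMarginal_eq_zero_of_not_mem _ _ t hZ)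
    (fun _ hk t => transportedMarginal_reg_eq_zero_of_lt hε hε' W hk t) hH1
    (transportedMarginal_oneStep_sharp hε hε' W hd hWm hC hβ hWb hH1) s ht

/-- Marginals of a function vanishing off the hard-sphere domain vanish off the hard-sphere
domains (every extension of an excluded sub-configuration is excluded). [folklore] -/
theorem nthMarginal_eq_zero_of_not_mem_of_vanish
    (hWD : ∀ z ∉ hardSphereDomain (Torus.geometry d) N ε, W z = 0) (s : ℕ)
    {Zs : Config s d (UnitAddTorus d)} (hZs : Zs ∉ hardSphereDomain (Torus.geometry d) s ε) :
    nthMarginal N s W Zs = 0 := by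
  unfold nthMarginal
  split_ifs with hs
  · unfold marginal
    refine integral_eq_zero_of_ae (Eventually.of_forall fun Zm => ?_)
    exact hWD _ (append_not_mem_hardSphereDomain (Nat.add_sub_of_le hs).symm hZs Zm)
  · rfl

include hε hε' in
/-- `1_{good} W = W` almost everywhere, for `W` vanishing off the hard-sphere domain
(`D_ε^N ∖ good` is Lebesgue-null). [folklore] -/
theorem indicator_good_ae_eq_of_vanish (hWD : ∀ z ∉ hardSphereDomain (Torus.geometry d) N ε, W z = 0) :
    (Alexander.good (Torus.geometry d) ε).indicator W =ᵐ[volume] W := by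
  have h := HardSphereFlow.volume_diff_good (d := d) (Alexander.regHardSphereFlow (d := d) hε hε' N)
  simp only [Alexander.regHardSphereFlow_good] at h
  filter_upwards [measure_eq_zero_iff_ae_notMem.1 h] with z hz
  by_cases hzg : z ∈ Alexander.good (Torus.geometry d) ε
  · rw [indicator_of_mem hzg]
  · rw [indicator_of_notMem hzg]
    have hzD : z ∉ hardSphereDomain (Torus.geometry d) N ε := fun hD => hz ⟨hD, hzg⟩
    exact (hWD z hzD).symm

/-- Marginals of measurable Gaussian-bounded functions are in the Lanford class. [folklore] -/
theorem isNice_nthMarginal_of_gaussian (hWm : Measurable W) {C β : ℝ} (hC : 0 ≤ C) (hβ : 0 < β)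
    (hWb : ∀ z, |W z| ≤ C * Real.exp (-β * configEnergy z)) (s : ℕ) : IsNice (nthMarginal N s W) := by
  refine ⟨measurable_nthMarginal N s hWm,
    C * (∫ Zm : Config (N - s) d (UnitAddTorus d), Real.exp (-β * configEnergy Zm)), β, hβ, fun Z => ?_⟩
  rcases le_or_gt s N with hs | hs
  · exact abs_nthMarginal_le_gaussian hs hβ hWb Z
  · simp only [nthMarginal, dif_neg (not_le.2 hs), Pi.zero_apply, abs_zero]
    have : 0 ≤ ∫ Zm : Config (N - s) d (UnitAddTorus d), Real.exp (-β * configEnergy Zm) :=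
      integral_nonneg fun _ => (Real.exp_pos _).le
    positivity

include hε hε' in
/-- **(S) with the honest initial marginals as data** (CIP 1994 (4.7); GST 2013 (4.3.8)): under the
hypotheses of `seriesFamily_ae_eq_transportedMarginal` and if moreover `W` vanishes off the
hard-sphere domain `D_ε^N`, the finite Duhamel series of the `N`-sphere model started from the
marginals `nthMarginal N · W` of the datum itself is a version of `f^{(s)}(t)`, for every `s` and
`t ≥ 0` — the time-`0` marginals `nthMarginal N · (1_{good} W)` and `nthMarginal N · W` agree almost
everywhere at every level and the Duhamel terms of the hard-sphere hierarchy respect null sets on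
domain-supported families (`hsHierarchyModel_respectsAEOn`). [cite: CIP1994, §4.4 (4.7)] -/
theorem seriesFamily_nthMarginal_ae_eq_transportedMarginal [DecidableEq d] (hd : 2 ≤ Fintype.card d)
    (hWm : Measurable W)
    (hWσ : ∀ (σ : Equiv.Perm (Fin N)) (z : Config N d (UnitAddTorus d)),
      W (z ∘ σ : Config N d (UnitAddTorus d)) = W z)
    {C β : ℝ} (hC : 0 ≤ C) (hβ : 0 < β) (hWb : ∀ z, |W z| ≤ C * Real.exp (-β * configEnergy z))
    (hWD : ∀ z ∉ hardSphereDomain (Torus.geometry d) N ε, W z = 0) (s : ℕ) {t : ℝ} (ht : 0 ≤ t) :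
    (hsHierarchyModel (d := d) hε hε' N).seriesFamily N (fun a => nthMarginal N a W) s t =ᵐ[volume]
      transportedMarginal (fun n => Alexander.regHardSphereFlow (d := d) hε hε' n) W s t := by
  have hR := hsHierarchyModel_respectsAEOn hε hε' hd N
  set G₁ : GCState d (UnitAddTorus d) := fun a =>
    transportedMarginal (fun n => Alexander.regHardSphereFlow (d := d) hε hε' n) W a 0 with hG₁
  set G₂ : GCState d (UnitAddTorus d) := fun a => nthMarginal N a W with hG₂
  have h₁ : ∀ a, IsNice (G₁ a) := fun a =>
    ((isNiceT_transportedMarginal_reg hε hε' W hWm hC hβ hWb a 0).isNice ⟨le_rfl, le_rfl⟩)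
  have h₂ : ∀ a, IsNice (G₂ a) := fun a => isNice_nthMarginal_of_gaussian W hWm hC hβ hWb a
  have s₁ : ∀ (a : ℕ) (Z : Config a d (UnitAddTorus d)), Z ∉ hardSphereDomain (Torus.geometry d) a ε → G₁ a Z = 0 :=
    fun a Z hZ => transportedMarginal_eq_zero_of_not_mem _ _ 0 hZ
  have s₂ : ∀ (a : ℕ) (Z : Config a d (UnitAddTorus d)), Z ∉ hardSphereDomain (Torus.geometry d) a ε → G₂ a Z = 0 :=
    fun a Z hZ => nthMarginal_eq_zero_of_not_mem_of_vanish W hWD a hZ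
  have hae : ∀ a, G₁ a =ᵐ[volume] G₂ a := by
    intro a
    simp only [hG₁, hG₂, transportedMarginal_reg_zero hε hε' W a]
    exact nthMarginal_congr_ae (indicator_good_ae_eq_of_vanish hε hε' W hWD)
  have hterm : ∀ n : ℕ,
      duhamelTerm (hsHierarchyModel (d := d) hε hε' N).transport (hsHierarchyModel hε hε' N).op n s t G₂ =ᵐ[volume]
        duhamelTerm (hsHierarchyModel (d := d) hε hε' N).transport (hsHierarchyModel hε hε' N).op n s t G₁ :=
    fun n => hR n s ht h₂ h₁ s₂ s₁ (fun a => (hae a).symm)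
  have hall := ae_all_iff.2 hterm
  have hS := seriesFamily_ae_eq_transportedMarginal hε hε' W hd hWm hWσ hC hβ hWb s ht
  filter_upwards [hall, hS] with Z hZ hZS
  rw [← hZS, HierarchyModel.seriesFamily_apply, HierarchyModel.seriesFamily_apply]
  exact Finset.sum_congr rfl fun n _ => hZ n

/-- **The marginals do not depend on the hard-sphere flow, almost everywhere** (GST 2013
Prop. 4.1.1): for every hard-sphere flow `Ψ` of the `N`-sphere system, the honest marginals of
`1_{good Ψ} W ∘ Ψ_{-t}` agree a.e. with those computed along the regularised flow
(`indicator_hsTransport_ae_eq_of_flows`, `nthMarginal_congr_ae`). [cite: GST2013, Prop. 4.1.1 p. 19] -/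
theorem nthMarginal_indicator_hsTransport_ae_eq (Ψ : HardSphereFlow (Torus.geometry d) ε N) (s : ℕ) (t : ℝ) :
    nthMarginal N s (Ψ.good.indicator (hsTransport Ψ t W)) =ᵐ[volume]
      transportedMarginal (fun n => Alexander.regHardSphereFlow (d := d) hε hε' n) W s t :=
  nthMarginal_congr_ae (indicator_hsTransport_ae_eq_of_flows Ψ (Alexander.regHardSphereFlow (d := d) hε hε' N) t W)

include hε hε' in
/-- **(S) along an arbitrary hard-sphere flow, with the honest initial marginals as data**: for
`d ≥ 2`, `0 < ε < 1/2`, a measurable permutation-symmetric `W` vanishing off `D_ε^N` with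
`|W| ≤ C e^{-βE}` (`β > 0`), every hard-sphere flow `Ψ` of the `N`-sphere system, every `s` and
`t ≥ 0`, `nthMarginal N s (1_{good Ψ} W ∘ Ψ_{-t})` equals a.e. the finite Duhamel series of the
`N`-sphere model started from `nthMarginal N · W`. [cite: CIP1994, §4.4 (4.7)] -/
theorem nthMarginal_indicator_hsTransport_ae_eq_seriesFamily [DecidableEq d] (hd : 2 ≤ Fintype.card d)
    (hWm : Measurable W)
    (hWσ : ∀ (σ : Equiv.Perm (Fin N)) (z : Config N d (UnitAddTorus d)),
      W (z ∘ σ : Config N d (UnitAddTorus d)) = W z)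
    {C β : ℝ} (hC : 0 ≤ C) (hβ : 0 < β) (hWb : ∀ z, |W z| ≤ C * Real.exp (-β * configEnergy z))
    (hWD : ∀ z ∉ hardSphereDomain (Torus.geometry d) N ε, W z = 0)
    (Ψ : HardSphereFlow (Torus.geometry d) ε N) (s : ℕ) {t : ℝ} (ht : 0 ≤ t) :
    nthMarginal N s (Ψ.good.indicator (hsTransport Ψ t W)) =ᵐ[volume]
      (hsHierarchyModel (d := d) hε hε' N).seriesFamily N (fun a => nthMarginal N a W) s t :=
  (nthMarginal_indicator_hsTransport_ae_eq hε hε' W Ψ s t).trans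
    (seriesFamily_nthMarginal_ae_eq_transportedMarginal hε hε' W hd hWm hWσ hC hβ hWb hWD s ht).symm

end Series

end Kinetic

end

end Literature.MathematicalPhysics.KineticTheory
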